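import Summits.CriticalPhenomena.SAWScalingLimit.Theses.SAWPhaseRetrieval
import Summits.CriticalPhenomena.SAWScalingLimit.Theorems.SAWPhaseRetrievalRetrievalStabilityDiscAlgebra
import Literature.Probability.LatticeModels.TriangularLatticeProofs
import Literature.Barriers.CriticalPhenomena.ParafermionicHalfCauchyRiemann

/-!
# Retrieval stability, disc case — the rhombus tile, I: segment comparisons

For the proof of `SAWPhaseRetrieval.RetrievalStabilityDisc` (stmt-CriticalPhenomena-11413).
The TILE with base `(a₀, b₀)` and side `ρ` is the 120°-rhombus of `𝕋` with sites
`site(s,t) = ![a₀ + s - t, b₀ + t]`, `0 ≤ s, t ≤ ρ` (embedded: `a₀ + b₀ ζ + s + t ζ²`).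
Given a lattice potential `p` whose increments on the tile's unit edges are the edge values of `G`
(hypotheses `HH/HV/HD` below, produced by the Potential file) and phases of `G` within `ε` of `1`
(hypotheses `PC/PB/PA`), we compare "image lengths" `F = Σ ‖G e‖` of lattice segments:
the two lattice-equilateral triangles `(site(0,0), site(t,t), site(0,t))` and
`(site(t,t), site(ρ,t), site(ρ,ρ))` close up (potential differences around a closed lattice
triangle sum to zero), so by the three-reals lemma the row `t` has
`F(row t) ≥ (1 - 7ε) ℓ_D`, `ℓ_D = F(short diagonal)`, and the four sides of the tile are within
`7 ε ℓ_D` of `ℓ_D`.  Pure bookkeeping over `Finset.range` sums; no definitions (local notation).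
-/

namespace Summit.CriticalPhenomena.SAWScalingLimit.Theorems

open Literature.Probability.LatticeModels Complex Finset

local notation "EA[" a "," b "]" =>
  (s(((![a, b] : Site 2), (0 : Fin 2)), ((![a, b] : Site 2), (1 : Fin 2))) : Sym2 HexVertex)
local notation "EB[" a "," b "]" =>
  (s(((![a, b] : Site 2), (0 : Fin 2)), ((![a - 1, b] : Site 2), (1 : Fin 2))) : Sym2 HexVertex)
local notation "EC[" a "," b "]" =>
  (s(((![a, b] : Site 2), (0 : Fin 2)), ((![a, b - 1] : Site 2), (1 : Fin 2))) : Sym2 HexVertex)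

/-! ### Telescoping along a lattice path -/

/-- Telescoping: if `u (k+1) - u k = c * g k` for `k < n` then `u n - u 0 = c * Σ_{k<n} g k`.
[folklore] -/
theorem rsd_telescope (u g : ℕ → ℂ) (c : ℂ) (n : ℕ) (h : ∀ k, k < n → u (k + 1) - u k = c * g k) :
    u n - u 0 = c * ∑ k ∈ range n, g k := by
  rw [← Finset.sum_range_sub, Finset.mul_sum]
  exact Finset.sum_congr rfl fun k hk => h k (Finset.mem_range.1 hk)

/-! ### The two families of closed lattice triangles in the tile -/

/-- **Triangle 1** (`site(0,0) = (a₀,b₀)`, `site(t,t) = (a₀, b₀+t)`, `site(0,t) = (a₀-t, b₀+t)`):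
the sums of `G` along the row-`t` piece (direction `1`), the left side piece (direction `ζ²`) and
the diagonal piece (direction `ζ`) close up: `Top + (ζ-1) Left - ζ Diag = 0`. [folklore] -/
theorem rsd_tri1_closure {G : Sym2 HexVertex → ℂ} {p : ℤ → ℤ → ℂ} {a₀ b₀ : ℤ} {ρ : ℕ}
    (hH : ∀ a b : ℤ, b₀ ≤ b → b ≤ b₀ + ρ → a₀ + b₀ ≤ a + b → a + b < a₀ + b₀ + ρ →
      p (a + 1) b - p a b = G EC[a, b]) (hV : ∀ a b : ℤ, b₀ ≤ b → b < b₀ + ρ → a₀ + b₀ ≤ a + b → a + b < a₀ + b₀ + ρ →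
      p a (b + 1) - p a b = triZeta * G EB[a, b]) (hD : ∀ a b : ℤ, b₀ ≤ b → b < b₀ + ρ → a₀ + b₀ ≤ a + b + 1 → a + b + 1 ≤ a₀ + b₀ + ρ →
      p a (b + 1) - p (a + 1) b = (triZeta - 1) * G EA[a, b])
    (t : ℕ) (ht : t ≤ ρ) :
    (∑ s ∈ range t, G EC[a₀ + s - t, b₀ + t]) +
      (triZeta - 1) * (∑ k ∈ range t, G EA[a₀ - k - 1, b₀ + k]) -
      triZeta * (∑ k ∈ range t, G EB[a₀, b₀ + k]) = 0 := by
  have htZ : (t : ℤ) ≤ ρ := by exact_mod_cast ht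
  -- row piece
  have e1 := rsd_telescope (fun k => p (a₀ + k - t) (b₀ + t)) (fun s => G EC[a₀ + s - t, b₀ + t]) 1
    t (fun k hk => by
      have hkZ : (k : ℤ) < t := by exact_mod_cast hk
      have := hH (a₀ + k - t) (b₀ + t) (by linarith) (by linarith) (by linarith) (by linarith)
      rw [one_mul, ← this]; push_cast; ring_nf)
  -- left piece
  have e2 := rsd_telescope (fun k => p (a₀ - k) (b₀ + k)) (fun k => G EA[a₀ - k - 1, b₀ + k])
    (triZeta - 1) t (fun k hk => by
      have hkZ : (k : ℤ) < t := by exact_mod_cast hk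
      have := hD (a₀ - k - 1) (b₀ + k) (by linarith) (by linarith) (by linarith) (by linarith)
      rw [← this]; push_cast; ring_nf)
  -- diagonal piece
  have e3 := rsd_telescope (fun k => p a₀ (b₀ + k)) (fun k => G EB[a₀, b₀ + k]) triZeta t
    (fun k hk => by
      have hkZ : (k : ℤ) < t := by exact_mod_cast hk
      have := hV a₀ (b₀ + k) (by linarith) (by linarith) (by linarith) (by linarith)
      rw [← this]; push_cast; ring_nf)
  simp only [Nat.cast_zero, sub_zero, add_zero, one_mul] at e1 e2 e3
  have e1' : p (a₀ + ↑t - ↑t) (b₀ + ↑t) = p a₀ (b₀ + t) := by rw [add_sub_cancel_right]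
  rw [e1'] at e1
  linear_combination -e1 - e2 + e3

/-- **Triangle 2** (`site(t,t) = (a₀, b₀+t)`, `site(t+n,t) = (a₀+n, b₀+t)`, `site(t+n,t+n) =
(a₀, b₀+t+n)`, `t + n ≤ ρ`): `Bot + (ζ-1) Right - ζ Diag = 0`. [folklore] -/
theorem rsd_tri2_closure {G : Sym2 HexVertex → ℂ} {p : ℤ → ℤ → ℂ} {a₀ b₀ : ℤ} {ρ : ℕ}
    (hH : ∀ a b : ℤ, b₀ ≤ b → b ≤ b₀ + ρ → a₀ + b₀ ≤ a + b → a + b < a₀ + b₀ + ρ →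
      p (a + 1) b - p a b = G EC[a, b]) (hV : ∀ a b : ℤ, b₀ ≤ b → b < b₀ + ρ → a₀ + b₀ ≤ a + b → a + b < a₀ + b₀ + ρ →
      p a (b + 1) - p a b = triZeta * G EB[a, b]) (hD : ∀ a b : ℤ, b₀ ≤ b → b < b₀ + ρ → a₀ + b₀ ≤ a + b + 1 → a + b + 1 ≤ a₀ + b₀ + ρ →
      p a (b + 1) - p (a + 1) b = (triZeta - 1) * G EA[a, b])
    (t n : ℕ) (htn : t + n ≤ ρ) :
    (∑ k ∈ range n, G EC[a₀ + ((t + k : ℕ) : ℤ) - t, b₀ + t]) +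
      (triZeta - 1) * (∑ k ∈ range n, G EA[a₀ + n - k - 1, b₀ + t + k]) -
      triZeta * (∑ k ∈ range n, G EB[a₀, b₀ + ((t + k : ℕ) : ℤ)]) = 0 := by
  have htnZ : (t : ℤ) + n ≤ ρ := by exact_mod_cast htn
  have e1 := rsd_telescope (fun k => p (a₀ + k) (b₀ + t))
    (fun k => G EC[a₀ + ((t + k : ℕ) : ℤ) - t, b₀ + t]) 1 n (fun k hk => by
      have hkZ : (k : ℤ) < n := by exact_mod_cast hk
      have := hH (a₀ + k) (b₀ + t) (by linarith) (by linarith) (by linarith) (by linarith)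
      have ek : a₀ + ((t + k : ℕ) : ℤ) - t = a₀ + k := by push_cast; ring
      rw [one_mul, ek, ← this]; push_cast; ring_nf)
  have e2 := rsd_telescope (fun k => p (a₀ + n - k) (b₀ + t + k))
    (fun k => G EA[a₀ + n - k - 1, b₀ + t + k]) (triZeta - 1) n (fun k hk => by
      have hkZ : (k : ℤ) < n := by exact_mod_cast hk
      have := hD (a₀ + n - k - 1) (b₀ + t + k) (by linarith) (by linarith) (by linarith)
        (by linarith)
      rw [← this]; push_cast; ring_nf)
  have e3 := rsd_telescope (fun k => p a₀ (b₀ + t + k))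
    (fun k => G EB[a₀, b₀ + ((t + k : ℕ) : ℤ)]) triZeta n (fun k hk => by
      have hkZ : (k : ℤ) < n := by exact_mod_cast hk
      have := hV a₀ (b₀ + t + k) (by linarith) (by linarith) (by linarith) (by linarith)
      have ek : b₀ + ((t + k : ℕ) : ℤ) = b₀ + t + k := by push_cast; ring
      rw [ek, ← this]; push_cast; ring_nf)
  simp only [Nat.cast_zero, sub_zero, add_zero, one_mul] at e1 e2 e3
  have e2' : p (a₀ + ↑n - ↑n) (b₀ + ↑t + ↑n) = p a₀ (b₀ + t + n) := by rw [add_sub_cancel_right]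
  rw [e2'] at e2
  linear_combination -e1 - e2 + e3

/-! ### Three reals, relative to a chosen reference -/

/-- From the three-reals square bound: the first two reals are within `7 ε z` of the third.
[folklore] -/
theorem rsd_three_ref_z {x y z ε : ℝ} (hx : 0 ≤ x) (hy : 0 ≤ y) (hz : 0 ≤ z) (hε : 0 ≤ ε)
    (hε1 : ε ≤ 1 / 10)
    (h : (x - y) ^ 2 + (y - z) ^ 2 + (z - x) ^ 2 ≤ 2 * ε ^ 2 * (x + y + z) ^ 2) :
    |x - z| ≤ 7 * ε * z ∧ |y - z| ≤ 7 * ε * z := by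
  obtain ⟨hxy, hyz, hzx⟩ := rsd_three_reals_pairwise hx hy hz hε h
  have h1 := (abs_le.1 hzx).1
  have h2 := (abs_le.1 hyz).2
  have hS : x + y + z ≤ 30 / 7 * z := by nlinarith
  have hb : 3 / 2 * ε * (x + y + z) ≤ 7 * ε * z := by nlinarith
  exact ⟨by rw [abs_sub_comm]; exact hzx.trans hb, hyz.trans hb⟩

/-- From the three-reals square bound: the last two reals are within `7 ε x` of the first.
[folklore] -/
theorem rsd_three_ref_x {x y z ε : ℝ} (hx : 0 ≤ x) (hy : 0 ≤ y) (hz : 0 ≤ z) (hε : 0 ≤ ε)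
    (hε1 : ε ≤ 1 / 10)
    (h : (x - y) ^ 2 + (y - z) ^ 2 + (z - x) ^ 2 ≤ 2 * ε ^ 2 * (x + y + z) ^ 2) :
    |y - x| ≤ 7 * ε * x ∧ |z - x| ≤ 7 * ε * x := by
  obtain ⟨hxy, _, hzx⟩ := rsd_three_reals_pairwise hx hy hz hε h
  exact rsd_three_reals_rel hx hy hz hε hε1 hxy hzx

/-! ### Row sums dominate the short diagonal -/

/-- **Row bound.** For every row `t ≤ ρ` of the tile, the image length of the row is at least
`(1 - 7ε)` times the image length `ℓ_D` of the short diagonal. [folklore] -/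
theorem rsd_row_ge {G : Sym2 HexVertex → ℂ} {p : ℤ → ℤ → ℂ} {ε : ℝ} {a₀ b₀ : ℤ} {ρ : ℕ}
    (hH : ∀ a b : ℤ, b₀ ≤ b → b ≤ b₀ + ρ → a₀ + b₀ ≤ a + b → a + b < a₀ + b₀ + ρ →
      p (a + 1) b - p a b = G EC[a, b]) (hV : ∀ a b : ℤ, b₀ ≤ b → b < b₀ + ρ → a₀ + b₀ ≤ a + b → a + b < a₀ + b₀ + ρ →
      p a (b + 1) - p a b = triZeta * G EB[a, b]) (hD : ∀ a b : ℤ, b₀ ≤ b → b < b₀ + ρ → a₀ + b₀ ≤ a + b + 1 → a + b + 1 ≤ a₀ + b₀ + ρ →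
      p a (b + 1) - p (a + 1) b = (triZeta - 1) * G EA[a, b])
    (hPC : ∀ a b : ℤ, b₀ ≤ b → b ≤ b₀ + ρ → a₀ + b₀ ≤ a + b → a + b < a₀ + b₀ + ρ →
      ‖G EC[a, b] - ((‖G EC[a, b]‖ : ℝ) : ℂ)‖ ≤ ε * ‖G EC[a, b]‖) (hPB : ∀ a b : ℤ, b₀ ≤ b → b < b₀ + ρ → a₀ + b₀ ≤ a + b → a + b < a₀ + b₀ + ρ →
      ‖G EB[a, b] - ((‖G EB[a, b]‖ : ℝ) : ℂ)‖ ≤ ε * ‖G EB[a, b]‖) (hPA : ∀ a b : ℤ, b₀ ≤ b → b < b₀ + ρ → a₀ + b₀ ≤ a + b + 1 → a + b + 1 ≤ a₀ + b₀ + ρ →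
      ‖G EA[a, b] - ((‖G EA[a, b]‖ : ℝ) : ℂ)‖ ≤ ε * ‖G EA[a, b]‖)
    (hε : 0 ≤ ε) (hε1 : ε ≤ 1 / 10) (t : ℕ) (ht : t ≤ ρ) :
    (1 - 7 * ε) * (∑ k ∈ range ρ, ‖G EB[a₀, b₀ + k]‖) ≤
      ∑ s ∈ range ρ, ‖G EC[a₀ + s - t, b₀ + t]‖ := by
  have htZ : (t : ℤ) ≤ ρ := by exact_mod_cast ht
  obtain ⟨n, rfl⟩ : ∃ n, ρ = t + n := ⟨ρ - t, by omega⟩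
  have hnZ : ((t + n : ℕ) : ℤ) = t + n := by push_cast; ring
  rw [Finset.sum_range_add, Finset.sum_range_add]
  -- Triangle 1: row piece `[0,t)` vs diagonal piece `[0,t)`
  have c1 := rsd_tri1_closure hH hV hD t ht
  have x1 : ‖(∑ s ∈ range t, G EC[a₀ + s - t, b₀ + t]) -
      ((∑ s ∈ range t, ‖G EC[a₀ + s - t, b₀ + t]‖ : ℝ) : ℂ)‖ ≤
      ε * ∑ s ∈ range t, ‖G EC[a₀ + s - t, b₀ + t]‖ :=
    rsd_norm_sum_sub_le _ _ fun s hs => by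
      have hsZ : (s : ℤ) < t := by exact_mod_cast Finset.mem_range.1 hs
      exact hPC _ _ (by linarith) (by linarith) (by linarith) (by linarith)
  have y1 : ‖(∑ k ∈ range t, G EA[a₀ - k - 1, b₀ + k]) -
      ((∑ k ∈ range t, ‖G EA[a₀ - k - 1, b₀ + k]‖ : ℝ) : ℂ)‖ ≤
      ε * ∑ k ∈ range t, ‖G EA[a₀ - k - 1, b₀ + k]‖ :=
    rsd_norm_sum_sub_le _ _ fun k hk => by
      have hkZ : (k : ℤ) < t := by exact_mod_cast Finset.mem_range.1 hk
      exact hPA _ _ (by linarith) (by linarith) (by linarith) (by linarith)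
  have z1 : ‖(∑ k ∈ range t, G EB[a₀, b₀ + k]) -
      ((∑ k ∈ range t, ‖G EB[a₀, b₀ + k]‖ : ℝ) : ℂ)‖ ≤ ε * ∑ k ∈ range t, ‖G EB[a₀, b₀ + k]‖ :=
    rsd_norm_sum_sub_le _ _ fun k hk => by
      have hkZ : (k : ℤ) < t := by exact_mod_cast Finset.mem_range.1 hk
      exact hPB _ _ (by linarith) (by linarith) (by linarith) (by linarith)
  have T1 := rsd_three_reals c1 x1 y1 z1
  have R1 := (rsd_three_ref_z (Finset.sum_nonneg fun _ _ => norm_nonneg _)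
    (Finset.sum_nonneg fun _ _ => norm_nonneg _) (Finset.sum_nonneg fun _ _ => norm_nonneg _)
    hε hε1 T1).1
  -- Triangle 2: row piece `[t, t+n)` vs diagonal piece `[t, t+n)`
  have c2 := rsd_tri2_closure hH hV hD t n le_rfl
  have x2 : ‖(∑ k ∈ range n, G EC[a₀ + ((t + k : ℕ) : ℤ) - t, b₀ + t]) -
      ((∑ k ∈ range n, ‖G EC[a₀ + ((t + k : ℕ) : ℤ) - t, b₀ + t]‖ : ℝ) : ℂ)‖ ≤
      ε * ∑ k ∈ range n, ‖G EC[a₀ + ((t + k : ℕ) : ℤ) - t, b₀ + t]‖ :=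
    rsd_norm_sum_sub_le _ _ fun k hk => by
      have hkZ : (k : ℤ) < n := by exact_mod_cast Finset.mem_range.1 hk
      exact hPC _ _ (by linarith) (by linarith) (by push_cast; linarith) (by push_cast; linarith)
  have y2 : ‖(∑ k ∈ range n, G EA[a₀ + n - k - 1, b₀ + t + k]) -
      ((∑ k ∈ range n, ‖G EA[a₀ + n - k - 1, b₀ + t + k]‖ : ℝ) : ℂ)‖ ≤
      ε * ∑ k ∈ range n, ‖G EA[a₀ + n - k - 1, b₀ + t + k]‖ :=
    rsd_norm_sum_sub_le _ _ fun k hk => by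
      have hkZ : (k : ℤ) < n := by exact_mod_cast Finset.mem_range.1 hk
      exact hPA _ _ (by linarith) (by linarith) (by linarith) (by linarith)
  have z2 : ‖(∑ k ∈ range n, G EB[a₀, b₀ + ((t + k : ℕ) : ℤ)]) -
      ((∑ k ∈ range n, ‖G EB[a₀, b₀ + ((t + k : ℕ) : ℤ)]‖ : ℝ) : ℂ)‖ ≤
      ε * ∑ k ∈ range n, ‖G EB[a₀, b₀ + ((t + k : ℕ) : ℤ)]‖ :=
    rsd_norm_sum_sub_le _ _ fun k hk => by
      have hkZ : (k : ℤ) < n := by exact_mod_cast Finset.mem_range.1 hk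
      exact hPB _ _ (by push_cast; linarith) (by push_cast; linarith) (by push_cast; linarith)
        (by push_cast; linarith)
  have T2 := rsd_three_reals c2 x2 y2 z2
  have R2 := (rsd_three_ref_z (Finset.sum_nonneg fun _ _ => norm_nonneg _)
    (Finset.sum_nonneg fun _ _ => norm_nonneg _) (Finset.sum_nonneg fun _ _ => norm_nonneg _)
    hε hε1 T2).1
  have h1 := (abs_le.1 R1).1
  have h2 := (abs_le.1 R2).1
  nlinarith [h1, h2, Finset.sum_nonneg (fun k (_ : k ∈ range t) => norm_nonneg (G EB[a₀, b₀ + k])),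
    Finset.sum_nonneg (fun k (_ : k ∈ range n) => norm_nonneg (G EB[a₀, b₀ + ((t + k : ℕ) : ℤ)]))]

/-- **Mean bound.** Summing the row bound over the `2ρ` horizontal edges-rows of the `2ρ²`
triangles of the tile: `Σ_{t<ρ} (F(row t) + F(row t+1)) ≥ 2ρ (1-7ε) ℓ_D`. [folklore] -/
theorem rsd_mean_ge {G : Sym2 HexVertex → ℂ} {p : ℤ → ℤ → ℂ} {ε : ℝ} {a₀ b₀ : ℤ} {ρ : ℕ}
    (hH : ∀ a b : ℤ, b₀ ≤ b → b ≤ b₀ + ρ → a₀ + b₀ ≤ a + b → a + b < a₀ + b₀ + ρ →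
      p (a + 1) b - p a b = G EC[a, b]) (hV : ∀ a b : ℤ, b₀ ≤ b → b < b₀ + ρ → a₀ + b₀ ≤ a + b → a + b < a₀ + b₀ + ρ →
      p a (b + 1) - p a b = triZeta * G EB[a, b]) (hD : ∀ a b : ℤ, b₀ ≤ b → b < b₀ + ρ → a₀ + b₀ ≤ a + b + 1 → a + b + 1 ≤ a₀ + b₀ + ρ →
      p a (b + 1) - p (a + 1) b = (triZeta - 1) * G EA[a, b])
    (hPC : ∀ a b : ℤ, b₀ ≤ b → b ≤ b₀ + ρ → a₀ + b₀ ≤ a + b → a + b < a₀ + b₀ + ρ →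
      ‖G EC[a, b] - ((‖G EC[a, b]‖ : ℝ) : ℂ)‖ ≤ ε * ‖G EC[a, b]‖) (hPB : ∀ a b : ℤ, b₀ ≤ b → b < b₀ + ρ → a₀ + b₀ ≤ a + b → a + b < a₀ + b₀ + ρ →
      ‖G EB[a, b] - ((‖G EB[a, b]‖ : ℝ) : ℂ)‖ ≤ ε * ‖G EB[a, b]‖) (hPA : ∀ a b : ℤ, b₀ ≤ b → b < b₀ + ρ → a₀ + b₀ ≤ a + b + 1 → a + b + 1 ≤ a₀ + b₀ + ρ →
      ‖G EA[a, b] - ((‖G EA[a, b]‖ : ℝ) : ℂ)‖ ≤ ε * ‖G EA[a, b]‖)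
    (hε : 0 ≤ ε) (hε1 : ε ≤ 1 / 10) :
    2 * ρ * ((1 - 7 * ε) * ∑ k ∈ range ρ, ‖G EB[a₀, b₀ + k]‖) ≤
      ∑ t ∈ range ρ, ((∑ s ∈ range ρ, ‖G EC[a₀ + s - t, b₀ + t]‖) +
        ∑ s ∈ range ρ, ‖G EC[a₀ + s - ((t + 1 : ℕ) : ℤ), b₀ + ((t + 1 : ℕ) : ℤ)]‖) := by
  have key : ∀ t ∈ range ρ, 2 * ((1 - 7 * ε) * ∑ k ∈ range ρ, ‖G EB[a₀, b₀ + k]‖) ≤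
      (∑ s ∈ range ρ, ‖G EC[a₀ + s - t, b₀ + t]‖) +
        ∑ s ∈ range ρ, ‖G EC[a₀ + s - ((t + 1 : ℕ) : ℤ), b₀ + ((t + 1 : ℕ) : ℤ)]‖ := by
    intro t ht
    have ht' : t < ρ := Finset.mem_range.1 ht
    have h1 := rsd_row_ge hH hV hD hPC hPB hPA hε hε1 t ht'.le
    have h2 := rsd_row_ge hH hV hD hPC hPB hPA hε hε1 (t + 1) ht'
    linarith
  have := Finset.sum_le_sum key
  rw [Finset.sum_const, Finset.card_range, nsmul_eq_mul] at this
  linarith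

/-- **Side bounds.** The image lengths of the four sides of the tile (bottom, right, top, left)
are within `7 ε ℓ_D` of the image length `ℓ_D` of the short diagonal. [folklore] -/
theorem rsd_sides {G : Sym2 HexVertex → ℂ} {p : ℤ → ℤ → ℂ} {ε : ℝ} {a₀ b₀ : ℤ} {ρ : ℕ}
    (hH : ∀ a b : ℤ, b₀ ≤ b → b ≤ b₀ + ρ → a₀ + b₀ ≤ a + b → a + b < a₀ + b₀ + ρ →
      p (a + 1) b - p a b = G EC[a, b]) (hV : ∀ a b : ℤ, b₀ ≤ b → b < b₀ + ρ → a₀ + b₀ ≤ a + b → a + b < a₀ + b₀ + ρ →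
      p a (b + 1) - p a b = triZeta * G EB[a, b]) (hD : ∀ a b : ℤ, b₀ ≤ b → b < b₀ + ρ → a₀ + b₀ ≤ a + b + 1 → a + b + 1 ≤ a₀ + b₀ + ρ →
      p a (b + 1) - p (a + 1) b = (triZeta - 1) * G EA[a, b])
    (hPC : ∀ a b : ℤ, b₀ ≤ b → b ≤ b₀ + ρ → a₀ + b₀ ≤ a + b → a + b < a₀ + b₀ + ρ →
      ‖G EC[a, b] - ((‖G EC[a, b]‖ : ℝ) : ℂ)‖ ≤ ε * ‖G EC[a, b]‖) (hPB : ∀ a b : ℤ, b₀ ≤ b → b < b₀ + ρ → a₀ + b₀ ≤ a + b → a + b < a₀ + b₀ + ρ →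
      ‖G EB[a, b] - ((‖G EB[a, b]‖ : ℝ) : ℂ)‖ ≤ ε * ‖G EB[a, b]‖) (hPA : ∀ a b : ℤ, b₀ ≤ b → b < b₀ + ρ → a₀ + b₀ ≤ a + b + 1 → a + b + 1 ≤ a₀ + b₀ + ρ →
      ‖G EA[a, b] - ((‖G EA[a, b]‖ : ℝ) : ℂ)‖ ≤ ε * ‖G EA[a, b]‖)
    (hε : 0 ≤ ε) (hε1 : ε ≤ 1 / 10) :
    |(∑ k ∈ range ρ, ‖G EC[a₀ + k, b₀]‖) - ∑ k ∈ range ρ, ‖G EB[a₀, b₀ + k]‖| ≤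
        7 * ε * ∑ k ∈ range ρ, ‖G EB[a₀, b₀ + k]‖ ∧
      |(∑ k ∈ range ρ, ‖G EA[a₀ + ρ - k - 1, b₀ + k]‖) - ∑ k ∈ range ρ, ‖G EB[a₀, b₀ + k]‖| ≤
        7 * ε * ∑ k ∈ range ρ, ‖G EB[a₀, b₀ + k]‖ ∧
      |(∑ s ∈ range ρ, ‖G EC[a₀ + s - ρ, b₀ + ρ]‖) - ∑ k ∈ range ρ, ‖G EB[a₀, b₀ + k]‖| ≤
        7 * ε * ∑ k ∈ range ρ, ‖G EB[a₀, b₀ + k]‖ ∧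
      |(∑ k ∈ range ρ, ‖G EA[a₀ - k - 1, b₀ + k]‖) - ∑ k ∈ range ρ, ‖G EB[a₀, b₀ + k]‖| ≤
        7 * ε * ∑ k ∈ range ρ, ‖G EB[a₀, b₀ + k]‖ := by
  have hρZ : (0 : ℤ) ≤ ρ := by exact_mod_cast Nat.zero_le ρ
  -- bottom and right: Triangle 2 with `t = 0`, `n = ρ`
  have c2 := rsd_tri2_closure hH hV hD 0 ρ (by omega)
  simp only [zero_add, Nat.cast_zero, add_zero, sub_zero] at c2
  have x2 : ‖(∑ k ∈ range ρ, G EC[a₀ + k, b₀]) - ((∑ k ∈ range ρ, ‖G EC[a₀ + k, b₀]‖ : ℝ) : ℂ)‖ ≤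
      ε * ∑ k ∈ range ρ, ‖G EC[a₀ + k, b₀]‖ :=
    rsd_norm_sum_sub_le _ _ fun k hk => by
      have hkZ : (k : ℤ) < ρ := by exact_mod_cast Finset.mem_range.1 hk
      exact hPC _ _ (by linarith) (by linarith) (by linarith) (by linarith)
  have y2 : ‖(∑ k ∈ range ρ, G EA[a₀ + ρ - k - 1, b₀ + k]) -
      ((∑ k ∈ range ρ, ‖G EA[a₀ + ρ - k - 1, b₀ + k]‖ : ℝ) : ℂ)‖ ≤
      ε * ∑ k ∈ range ρ, ‖G EA[a₀ + ρ - k - 1, b₀ + k]‖ :=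
    rsd_norm_sum_sub_le _ _ fun k hk => by
      have hkZ : (k : ℤ) < ρ := by exact_mod_cast Finset.mem_range.1 hk
      exact hPA _ _ (by linarith) (by linarith) (by linarith) (by linarith)
  have z2 : ‖(∑ k ∈ range ρ, G EB[a₀, b₀ + k]) - ((∑ k ∈ range ρ, ‖G EB[a₀, b₀ + k]‖ : ℝ) : ℂ)‖ ≤
      ε * ∑ k ∈ range ρ, ‖G EB[a₀, b₀ + k]‖ :=
    rsd_norm_sum_sub_le _ _ fun k hk => by
      have hkZ : (k : ℤ) < ρ := by exact_mod_cast Finset.mem_range.1 hk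
      exact hPB _ _ (by linarith) (by linarith) (by linarith) (by linarith)
  have T2 := rsd_three_reals c2 x2 y2 z2
  have R2 := rsd_three_ref_z (Finset.sum_nonneg fun _ _ => norm_nonneg _)
    (Finset.sum_nonneg fun _ _ => norm_nonneg _) (Finset.sum_nonneg fun _ _ => norm_nonneg _)
    hε hε1 T2
  -- top and left: Triangle 1 with `t = ρ`
  have c1 := rsd_tri1_closure hH hV hD ρ le_rfl
  have x1 : ‖(∑ s ∈ range ρ, G EC[a₀ + s - ρ, b₀ + ρ]) -
      ((∑ s ∈ range ρ, ‖G EC[a₀ + s - ρ, b₀ + ρ]‖ : ℝ) : ℂ)‖ ≤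
      ε * ∑ s ∈ range ρ, ‖G EC[a₀ + s - ρ, b₀ + ρ]‖ :=
    rsd_norm_sum_sub_le _ _ fun s hs => by
      have hsZ : (s : ℤ) < ρ := by exact_mod_cast Finset.mem_range.1 hs
      exact hPC _ _ (by linarith) (by linarith) (by linarith) (by linarith)
  have y1 : ‖(∑ k ∈ range ρ, G EA[a₀ - k - 1, b₀ + k]) -
      ((∑ k ∈ range ρ, ‖G EA[a₀ - k - 1, b₀ + k]‖ : ℝ) : ℂ)‖ ≤
      ε * ∑ k ∈ range ρ, ‖G EA[a₀ - k - 1, b₀ + k]‖ :=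
    rsd_norm_sum_sub_le _ _ fun k hk => by
      have hkZ : (k : ℤ) < ρ := by exact_mod_cast Finset.mem_range.1 hk
      exact hPA _ _ (by linarith) (by linarith) (by linarith) (by linarith)
  have T1 := rsd_three_reals c1 x1 y1 z2
  have R1 := rsd_three_ref_z (Finset.sum_nonneg fun _ _ => norm_nonneg _)
    (Finset.sum_nonneg fun _ _ => norm_nonneg _) (Finset.sum_nonneg fun _ _ => norm_nonneg _)
    hε hε1 T1
  exact ⟨R2.1, R2.2, R1.1, R1.2⟩

end Summit.CriticalPhenomena.SAWScalingLimit.Theorems
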